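import Summits.QuantumFields.QCD.Theorems.PauliWegnerSeaPhaseQuenchedFlavourDecayNegMomentSmallBalls
import Summits.QuantumFields.QCD.Theorems.PauliWegnerSeaPhaseQuenchedFlavourDecayPiMarginalInduction
import Summits.QuantumFields.QCD.Theorems.PauliWegnerSeaPhaseQuenchedFlavourDecayWilsonDetNegMoment
import Summits.QuantumFields.QCD.Theorems.PauliWegnerSeaPhaseQuenchedFlavourDecayEntryMomentIntegrable
import Summits.QuantumFields.QCD.Theorems.PauliWegnerSeaPhaseQuenchedFlavourDecayGramMomentIntegrableR1

/-!
# Negative moments of the Wilson determinant and finite phase-quenched `(1+ε)`-moments of propagator entries —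
the registered stubs `stub_wilsonDetNegMoment`, `stub_entryMomentIntegrable` of crux stmt-QuantumFields-9151
(`PauliWegnerSea.PhaseQuenchedFlavourDecay`, line `crossing-split-integrability`, lead c4)

Assembly only: the `_Of` forms (`…WilsonDetNegMoment`, `…EntryMomentIntegrable`) applied to the landed abstract inputs
`stub_negMomentOfSmallBalls` (dyadic layer cake) and `stub_piMarginalInduction` (induction over the coordinates of a
product probability space).  Result: there is `s₀ > 0`, depending on nothing (the single-link Remez small-ball exponent
of the `TiltedFlatness` circle-transport machinery), such that for `0 < s < s₀` the negative power `‖det D_W(U;M)‖^{-s}`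
is integrable under the Wilson measure on every torus of side `≥ 4`, for every `β` and `M`; consequently every
same-flavour propagator entry has a finite phase-quenched `(1+ε)`-th moment for `0 < ε < s₀` — the integrability
conjunct of `MinorMoments` at `r = 1` (and of `GramMoments` at `r = 1` by subadditivity), with a volume-, `β`- and
mass-independent exponent window.  The uniform BOUND on these moments (the open core `stub_gramMomentsCore`) is not
touched.  `gramMomentIntegrable_r1`: the same for the core's `r = 1` Gram integrand (`…GramMomentIntegrableR1`).
-/

noncomputable section

namespace Summit.QuantumFields.QCD.Cruxes.PhaseQuenchedFlavourDecay.CrossingSplitIntegrability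

open MeasureTheory
open Literature.MathematicalPhysics.QuantumFieldTheory Literature.MathematicalPhysics.QuantumLattice
  Literature.Probability.LatticeModels

/-- **stub `stub_wilsonDetNegMoment` (registered additive stub of crux stmt-QuantumFields-9151)** — uniform-window
negative moments of the Wilson fermion determinant: there is `s₀ > 0` such that for every `0 < s < s₀`, every torus of
side `L ≥ 4`, every `β` and every bare mass `M`, `U ↦ ‖det D_W(U; M)‖^{-s}` is integrable under the Wilson measure. -/
theorem stub_wilsonDetNegMoment :
    ∃ s₀ : ℝ, 0 < s₀ ∧ ∀ s : ℝ, 0 < s → s < s₀ → ∀ (L : ℕ) [NeZero L], 4 ≤ L → ∀ (β M : ℝ),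
      MeasureTheory.Integrable
        (fun U : GaugeConfig 4 L SU3 => ‖(wilsonDirac (fundamentalRep (Fin 3)) U M 1).det‖ ^ (-s))
        (wilsonMeasure (fundamentalRep (Fin 3)) β) :=
  stub_wilsonDetNegMomentOf stub_negMomentOfSmallBalls stub_piMarginalInduction

/-- **stub `stub_entryMomentIntegrable` (registered additive stub of crux stmt-QuantumFields-9151)** — the
INTEGRABILITY conjunct of `MinorMoments` at `r = 1`: there is `s₀ > 0` such that for every `0 < ε < s₀`, every `N_f`,
every torus of side `L ≥ 4`, every `β`, mass vector, flavour `f` and quark indices `p, q`, the phase-quenched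
`(1+ε)`-th moment of the propagator entry `‖G_f(p,q)‖` is finite (`Integrable` under `qcdLatticeMeasure`). -/
theorem stub_entryMomentIntegrable :
    ∃ s₀ : ℝ, 0 < s₀ ∧ ∀ ε : ℝ, 0 < ε → ε < s₀ → ∀ (Nf L : ℕ) [NeZero L], 4 ≤ L →
      ∀ (β : ℝ) (mq : Fin Nf → ℝ) (f : Fin Nf) (p q : TorusSite 4 L × Fin 3 × Fin 4),
        MeasureTheory.Integrable (fun U : GaugeConfig 4 L SU3 =>
          ‖(diracMatrix U mq)⁻¹ (quarkEquiv (f, p)) (quarkEquiv (f, q))‖ ^ (1 + ε)) (qcdLatticeMeasure L β mq) :=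
  stub_entryMomentIntegrableOf stub_wilsonDetNegMoment

/-- **Integrability conjunct of `GramMoments` at `r = 1`, unconditionally**: for `1/2 < q < (1+s₀)/2`, `q ≤ 1`, every
`N_f`, torus of side `L ≥ 4`, `β`, mass vector and row `I : Fin 1 → QuarkVar`, the open core's `r = 1` integrand
`(Re det((G Gᴴ)[I,I]))^q` is integrable under `qcdLatticeMeasure`. -/
theorem gramMomentIntegrable_r1 :
    ∃ s₀ : ℝ, 0 < s₀ ∧ ∀ q : ℝ, 1 / 2 < q → q < (1 + s₀) / 2 → q ≤ 1 → ∀ (Nf L : ℕ) [NeZero L], 4 ≤ L →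
      ∀ (β : ℝ) (mq : Fin Nf → ℝ) (I : Fin 1 → QuarkVar Nf L),
        MeasureTheory.Integrable (fun U : GaugeConfig 4 L SU3 =>
          (Matrix.of fun a b : Fin 1 =>
            ((diracMatrix U mq)⁻¹ * ((diracMatrix U mq)⁻¹).conjTranspose)
              (quarkEquiv (I a)) (quarkEquiv (I b))).det.re ^ q) (qcdLatticeMeasure L β mq) :=
  stub_gramMomentIntegrableR1Of stub_entryMomentIntegrable

end Summit.QuantumFields.QCD.Cruxes.PhaseQuenchedFlavourDecay.CrossingSplitIntegrability

end
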